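import Summits.QuantumFields.BalabanUV.T4Continuum.Spine.NE2.CovariantTableAveraging
import Summits.QuantumFields.BalabanUV.T4Continuum.Support.CovariantBlockAveragingPairing

/-!
# T⁴ programme, spine node NE2 (U1a) — R14 W1, file 2: THE TWO-LEVEL PAIRING OF THE TABLE AVERAGING `Q_k(T)` — the entry identity
# (cell `pub-balaban-gaps`, seat ne2 gen 3; plan `run/shared/lean/pub/pub-balaban-gaps/ne/NE2-R14-PLAN.md` W1)

Row B3.b-conc's `Support/CovariantBlockAveragingPairing` proves the ENTRY IDENTITY `pairing_apply` of the two-level pairing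
`D = √(L^d)·(Q′(R′) − Q′ ⊗ 1)(J_L ⊗ 1) − (Q(R) − Q ⊗ 1)` for the contour transporters `ctr` of ONE bond field.  THIS FILE is the same identity for ARBITRARY TRANSPORTER TABLES
`T′` (level `L·n`) and `T` (level `n`) of `Spine/NE2/CovariantTableAveraging.QcovT`: **`pairDT`**, `sum_parT_sub_kron_applyT`, `sum_parT_sub_kron_apply_glueT`, **`pairing_applyT`** —
the proofs are row B3's VERBATIM with `ctr M N R y j μ t` replaced by `T y j μ t` (they read the transporters only as table entries); the generic pieces `mul_JK_kron_apply`,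
`sqrt_mul_consts`, `tent_transport`, `glue`/`sum_glue`/`par_bpt_glue_add_tstep` are row B3's BY NAME.  File 3 (the norm laws `norm_pairing_apply_le`/`opNorm_pairing_le` with
the table's size `hTτ` and two-level consistency `hT2` DISPLAYED, and the tower packaging) completes W1.
HONEST FRAMING (T4-DAG p. 1).  Bookkeeping about TYPED operators; `T`, `T′` DATA; nothing of [B7] (124)/(15) constructed (DIVERGENCE F6 (ζ)); NOT NE2, NOT [B9] (3.16)/(3.26) as
printed; NE2 (U1a) NOT PROVED; spine PROVED 0/9 unchanged; NOT continuum YM / infinite volume / mass gap / Clay.  HONEST DEPENDENCY: continuum YM on T⁴ ⇐ BetaPertH ∧ nine spine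
estimates (0/9 proved); BetaPertH ⇐ (D1) ∧ (D4) ∧ CAP+tail; G-an2-4 gates asym, D1 and NE2/3/4.  No `sorry`.
-/

noncomputable section

open scoped BigOperators ComplexConjugate Matrix Matrix.Norms.L2Operator Kronecker
open Finset

namespace Summit.QuantumFields.BalabanUV.T4Continuum.NE2.CovariantTablePairing

open Literature.MathematicalPhysics.QuantumFieldTheory.Balaban1983to89.B5Prop11Plancherel (Tor fine unitVec Cst Cst_nonneg)
open Literature.MathematicalPhysics.QuantumFieldTheory.Balaban1983to89.B5Block118 (QvOp bpt tstep tstep_zero)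
open Literature.MathematicalPhysics.QuantumFieldTheory.Balaban1983to89.B5G183RateUnitTower (lev lev_neZero)
open Literature.MathematicalPhysics.QuantumFieldTheory.Balaban1983to89.Beta.DeltaACombesThomas (sum_blocks_ite)
open Summit.QuantumFields.BalabanUV.T4Continuum
open Summit.QuantumFields.BalabanUV.T4Continuum.BalabanAveragedTowerUnit (idx norm_entry_le_opNorm one_le_lev' cast_lev')
open Summit.QuantumFields.BalabanUV.T4Continuum.BalabanAveragedTowerModes (par)
open Summit.QuantumFields.BalabanUV.T4Continuum.KingPairingPlantedLaw (JK JpcT calDalev calDalev_inv opNorm_inv_calDalev_le sqrt_facts)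
open Summit.QuantumFields.BalabanUV.T4Continuum.BlockPairingGeometry (parT JK_apply)
open Summit.QuantumFields.BalabanUV.T4Continuum.LineAveragingPairing (glue sum_glue par_bpt_glue_add_tstep tent_count sum_fun_coord cL norm_cL_le)
open Summit.QuantumFields.BalabanUV.T4Continuum.KroneckerLift
open Summit.QuantumFields.BalabanUV.T4Continuum.CovariantBlockAveraging (mul_JK_kron_apply sqrt_mul_consts sum_fun_coord' tent_transport)
open Summit.QuantumFields.BalabanUV.T4Continuum.NE2.CovariantTableAveraging (Table QcovT QcovT_sub_kron_apply)

variable {d : ℕ}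

section TwoLevel

variable (n L : ℕ) [NeZero n] [NeZero L] (M : Fin d → ℕ) [hM : ∀ μ, NeZero (M μ)] {o : Type*} [Fintype o] [DecidableEq o]

/-! ## §1 The pairing matrix of two tables -/

/-- **THE TWO-LEVEL PAIRING MATRIX OF TWO TABLES** `D = √(L^d)·(Q′(T′) − Q′ ⊗ 1)(J_L ⊗ 1) − (Q(T) − Q ⊗ 1)` (unscaled by `√(n^d)`). [folklore] -/
def pairDT (T' : Table d (L * n) M o) (T : Table d n M o) :
    Matrix ((Tor M × Fin d) × o) ((Tor (fine n M) × Fin d) × o) ℂ :=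
  (((Real.sqrt ((L : ℝ) ^ d)) : ℝ) : ℂ) • ((QcovT (L * n) M T' - QvOp (L * n) M ⊗ₖ (1 : Matrix o o ℂ))
      * (JK n L M ⊗ₖ (1 : Matrix o o ℂ)))
    - (QcovT n M T - QvOp n M ⊗ₖ (1 : Matrix o o ℂ))

/-! ## §2 The entry identity -/

omit [Fintype o] in
/-- the FINE transport error planted on the coarse lattice, entrywise, BEFORE re-indexing:
`Σ_{i′: parT i′ = i} (Q′(R′) − Q′⊗1)(b,(i′,α′)) = [i.2 = μ]·Σ_{j′,t′} 𝟙[par(L·n·y + j′ + t′e_μ) = i.1]·(L n)^{−(d+1)}·(T′ − 1)_{αα′}`. [folklore] -/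
theorem sum_parT_sub_kron_applyT (T' : Table d (L * n) M o) (b : (Tor M × Fin d) × o)
    (i : Tor (fine n M) × Fin d) (α' : o) :
    ∑ i' : Tor (fine (L * n) M) × Fin d,
        (if parT n L M i' = i then (QcovT (L * n) M T' - QvOp (L * n) M ⊗ₖ (1 : Matrix o o ℂ)) b (i', α') else 0)
      = if i.2 = b.1.2 then
          ∑ j' : Fin d → Fin (L * n), ∑ t' : Fin (L * n),
            (if par n L M (bpt (L * n) M b.1.1 j' + tstep (fine (L * n) M) b.1.2 t') = i.1 then
              (1 / (((L * n : ℕ)) : ℂ) ^ (d + 1)) * (T' b.1.1 j' b.1.2 t' - 1) b.2 α' else 0)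
        else 0 := by
  -- rewrite each entry as a double sum of point indicators
  have hX : ∀ i' : Tor (fine (L * n) M) × Fin d,
      (QcovT (L * n) M T' - QvOp (L * n) M ⊗ₖ (1 : Matrix o o ℂ)) b (i', α')
        = ∑ j' : Fin d → Fin (L * n), ∑ t' : Fin (L * n),
            (if i' = (bpt (L * n) M b.1.1 j' + tstep (fine (L * n) M) b.1.2 t', b.1.2) then
              (1 / (((L * n : ℕ)) : ℂ) ^ (d + 1)) * (T' b.1.1 j' b.1.2 t' - 1) b.2 α' else 0) := by
    intro i'
    rw [QcovT_sub_kron_apply]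
    by_cases h : i'.2 = b.1.2
    · rw [if_pos h]
      push_cast
      refine Finset.sum_congr rfl fun j' _ => Finset.sum_congr rfl fun t' _ => ?_
      have hiff : i' = (bpt (L * n) M b.1.1 j' + tstep (fine (L * n) M) b.1.2 t', b.1.2)
          ↔ i'.1 = bpt (L * n) M b.1.1 j' + tstep (fine (L * n) M) b.1.2 t' :=
        ⟨fun hi => by rw [hi], fun hi => Prod.ext hi h⟩
      by_cases hc : i'.1 = bpt (L * n) M b.1.1 j' + tstep (fine (L * n) M) b.1.2 t'
      · rw [if_pos hc, if_pos (hiff.mpr hc)]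
      · rw [if_neg hc, if_neg (fun h' => hc (hiff.mp h'))]
    · rw [if_neg h]
      symm
      refine Finset.sum_eq_zero fun j' _ => Finset.sum_eq_zero fun t' _ => if_neg ?_
      intro hi; exact h (by rw [hi])
  simp_rw [hX]
  -- exchange the sums and evaluate the point indicator
  have hswap : ∑ i' : Tor (fine (L * n) M) × Fin d, (if parT n L M i' = i then
      ∑ j' : Fin d → Fin (L * n), ∑ t' : Fin (L * n),
        (if i' = (bpt (L * n) M b.1.1 j' + tstep (fine (L * n) M) b.1.2 t', b.1.2) then
          (1 / (((L * n : ℕ)) : ℂ) ^ (d + 1)) * (T' b.1.1 j' b.1.2 t' - 1) b.2 α' else 0) else 0)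
      = ∑ j' : Fin d → Fin (L * n), ∑ t' : Fin (L * n),
          (if parT n L M (bpt (L * n) M b.1.1 j' + tstep (fine (L * n) M) b.1.2 t', b.1.2) = i then
            (1 / (((L * n : ℕ)) : ℂ) ^ (d + 1)) * (T' b.1.1 j' b.1.2 t' - 1) b.2 α' else 0) := by
    have e : ∀ i' : Tor (fine (L * n) M) × Fin d, (if parT n L M i' = i then
        ∑ j' : Fin d → Fin (L * n), ∑ t' : Fin (L * n),
          (if i' = (bpt (L * n) M b.1.1 j' + tstep (fine (L * n) M) b.1.2 t', b.1.2) then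
            (1 / (((L * n : ℕ)) : ℂ) ^ (d + 1)) * (T' b.1.1 j' b.1.2 t' - 1) b.2 α' else 0) else 0)
        = ∑ j' : Fin d → Fin (L * n), ∑ t' : Fin (L * n),
          (if i' = (bpt (L * n) M b.1.1 j' + tstep (fine (L * n) M) b.1.2 t', b.1.2) then
            (if parT n L M (bpt (L * n) M b.1.1 j' + tstep (fine (L * n) M) b.1.2 t', b.1.2) = i then
              (1 / (((L * n : ℕ)) : ℂ) ^ (d + 1)) * (T' b.1.1 j' b.1.2 t' - 1) b.2 α' else 0) else 0) := by
      intro i'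
      by_cases hp : parT n L M i' = i
      · rw [if_pos hp]
        refine Finset.sum_congr rfl fun j' _ => Finset.sum_congr rfl fun t' _ => ?_
        by_cases hi : i' = (bpt (L * n) M b.1.1 j' + tstep (fine (L * n) M) b.1.2 t', b.1.2)
        · rw [if_pos hi, if_pos hi, ← hi, if_pos hp]
        · rw [if_neg hi, if_neg hi]
      · rw [if_neg hp]
        symm
        refine Finset.sum_eq_zero fun j' _ => Finset.sum_eq_zero fun t' _ => ?_
        by_cases hi : i' = (bpt (L * n) M b.1.1 j' + tstep (fine (L * n) M) b.1.2 t', b.1.2)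
        · rw [if_pos hi, ← hi, if_neg hp]
        · rw [if_neg hi]
    simp_rw [e]
    rw [Finset.sum_comm]
    refine Finset.sum_congr rfl fun j' _ => ?_
    rw [Finset.sum_comm]
    refine Finset.sum_congr rfl fun t' _ => ?_
    rw [Finset.sum_ite_eq' Finset.univ]
    simp
  rw [hswap]
  by_cases h : i.2 = b.1.2
  · rw [if_pos h]
    refine Finset.sum_congr rfl fun j' _ => Finset.sum_congr rfl fun t' _ => ?_
    have hiff : parT n L M (bpt (L * n) M b.1.1 j' + tstep (fine (L * n) M) b.1.2 t', b.1.2) = i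
        ↔ par n L M (bpt (L * n) M b.1.1 j' + tstep (fine (L * n) M) b.1.2 t') = i.1 := by
      rw [parT]
      constructor
      · intro hi; rw [← hi]
      · intro hi; exact Prod.ext hi h.symm
    simp only [hiff]
  · rw [if_neg h]
    refine Finset.sum_eq_zero fun j' _ => Finset.sum_eq_zero fun t' _ => if_neg ?_
    intro hi
    exact h (by rw [← hi]; rfl)

omit [Fintype o] in
/-- after GLUING the fine offset `j′ = L·j + r`: the planted fine pair `(L·j + r, t′)` sits over the coarse point
`n·y + j + ⌊(r_μ + t′)/L⌋ e_μ`. [folklore] -/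
theorem sum_parT_sub_kron_apply_glueT (T' : Table d (L * n) M o) (b : (Tor M × Fin d) × o)
    (i : Tor (fine n M) × Fin d) (α' : o) :
    ∑ i' : Tor (fine (L * n) M) × Fin d,
        (if parT n L M i' = i then (QcovT (L * n) M T' - QvOp (L * n) M ⊗ₖ (1 : Matrix o o ℂ)) b (i', α') else 0)
      = if i.2 = b.1.2 then
          ∑ j : Fin d → Fin n, ∑ r : Fin d → Fin L, ∑ t' : Fin (L * n),
            (if bpt n M b.1.1 j + tstep (fine n M) b.1.2 (((r b.1.2 : ℕ) + t') / L) = i.1 then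
              (1 / (((L * n : ℕ)) : ℂ) ^ (d + 1)) * (T' b.1.1 (glue n L (j, r)) b.1.2 t' - 1) b.2 α' else 0)
        else 0 := by
  rw [sum_parT_sub_kron_applyT]
  split_ifs
  · rw [sum_glue]
    refine Finset.sum_congr rfl fun j _ => Finset.sum_congr rfl fun r _ => Finset.sum_congr rfl fun t' _ => ?_
    rw [par_bpt_glue_add_tstep]
  · rfl

/-- **THE ENTRY IDENTITY** of the two-level pairing (see the module docstring): consistency part + end-of-line part. [folklore] -/
theorem pairing_applyT (T' : Table d (L * n) M o) (T : Table d n M o)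
    (b : (Tor M × Fin d) × o) (i : Tor (fine n M) × Fin d) (α' : o) :
    pairDT n L M T' T b (i, α')
    = if i.2 = b.1.2 then
        (1 / (n : ℂ) ^ (d + 1)) *
          ((1 / (L : ℂ) ^ (d + 1)) *
              ∑ j : Fin d → Fin n, ∑ r : Fin d → Fin L, ∑ t' : Fin (L * n),
                (if bpt n M b.1.1 j + tstep (fine n M) b.1.2 (((r b.1.2 : ℕ) + t') / L) = i.1 then
                  (T' b.1.1 (glue n L (j, r)) b.1.2 t' - T b.1.1 j b.1.2 (((r b.1.2 : ℕ) + t') / L)) b.2 α'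
                 else 0)
            + cL L * ∑ j : Fin d → Fin n,
                ((if bpt n M b.1.1 j + tstep (fine n M) b.1.2 n = i.1 then (T b.1.1 j b.1.2 n - 1) b.2 α' else 0)
                 - (if bpt n M b.1.1 j + tstep (fine n M) b.1.2 0 = i.1 then (T b.1.1 j b.1.2 0 - 1) b.2 α' else 0)))
      else 0 := by
  have hL : 0 < L := Nat.pos_of_ne_zero (NeZero.ne L)
  have hLc : (L : ℂ) ≠ 0 := by exact_mod_cast hL.ne'
  have hnc : (n : ℂ) ≠ 0 := by exact_mod_cast NeZero.ne n
  rw [pairDT, Matrix.sub_apply, Matrix.smul_apply, smul_eq_mul, mul_JK_kron_apply, sum_parT_sub_kron_apply_glueT, QcovT_sub_kron_apply]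
  by_cases h : i.2 = b.1.2
  · simp only [if_pos h]
    rw [← mul_assoc, sqrt_mul_consts, one_mul]
    -- name the coarse indicator-weighted transporter entries
    set Φ : (Fin d → Fin n) → ℕ → ℂ := fun j s =>
      if bpt n M b.1.1 j + tstep (fine n M) b.1.2 s = i.1 then (T b.1.1 j b.1.2 s - 1) b.2 α' else 0 with hΦ
    -- the coarse side in terms of Φ
    have hcoarse : ∑ j : Fin d → Fin n, ∑ t : Fin n,
        (if i.1 = bpt n M b.1.1 j + tstep (fine n M) b.1.2 t then
          (1 / (n : ℂ) ^ (d + 1)) * (T b.1.1 j b.1.2 t - 1) b.2 α' else 0)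
        = (1 / (n : ℂ) ^ (d + 1)) * ∑ j : Fin d → Fin n, ∑ s : Fin n, Φ j s := by
      rw [Finset.mul_sum]
      refine Finset.sum_congr rfl fun j _ => ?_
      rw [Finset.mul_sum]
      refine Finset.sum_congr rfl fun s _ => ?_
      simp only [hΦ, eq_comm (a := i.1)]
      split_ifs <;> simp
    -- the fine side: split `T′ − 1 = (T′ − T) + (T − 1)` and apply the tent count to the second part
    have hfine : ∑ j : Fin d → Fin n, ∑ r : Fin d → Fin L, ∑ t' : Fin (L * n),
        (if bpt n M b.1.1 j + tstep (fine n M) b.1.2 (((r b.1.2 : ℕ) + t') / L) = i.1 then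
          (1 / (((L * n : ℕ)) : ℂ) ^ (d + 1)) * (T' b.1.1 (glue n L (j, r)) b.1.2 t' - 1) b.2 α' else 0)
        = (1 / (((L * n : ℕ)) : ℂ) ^ (d + 1)) *
          (∑ j : Fin d → Fin n, ∑ r : Fin d → Fin L, ∑ t' : Fin (L * n),
              (if bpt n M b.1.1 j + tstep (fine n M) b.1.2 (((r b.1.2 : ℕ) + t') / L) = i.1 then
                (T' b.1.1 (glue n L (j, r)) b.1.2 t' - T b.1.1 j b.1.2 (((r b.1.2 : ℕ) + t') / L)) b.2 α'
               else 0)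
            + ∑ j : Fin d → Fin n, ((L : ℂ) ^ (d + 1) * ∑ s : Fin n, Φ j s + (L : ℂ) ^ (d + 1) * cL L * (Φ j n - Φ j 0))) := by
      rw [mul_add, Finset.mul_sum, Finset.mul_sum, ← Finset.sum_add_distrib]
      refine Finset.sum_congr rfl fun j _ => ?_
      rw [← tent_transport n L (Φ j) b.1.2, ← mul_add, ← Finset.sum_add_distrib, Finset.mul_sum]
      refine Finset.sum_congr rfl fun r _ => ?_
      rw [← Finset.sum_add_distrib, Finset.mul_sum]
      refine Finset.sum_congr rfl fun t' _ => ?_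
      simp only [hΦ]
      split_ifs
      · rw [Matrix.sub_apply, Matrix.sub_apply, Matrix.sub_apply]; ring
      · simp
    rw [hfine, hcoarse]
    have hD : ∀ j : Fin d → Fin n,
        ((if bpt n M b.1.1 j + tstep (fine n M) b.1.2 n = i.1 then (T b.1.1 j b.1.2 n - 1) b.2 α' else 0)
          - (if bpt n M b.1.1 j + tstep (fine n M) b.1.2 0 = i.1 then (T b.1.1 j b.1.2 0 - 1) b.2 α' else 0))
          = Φ j n - Φ j 0 := fun j => rfl
    simp only [hD]
    rw [Finset.sum_add_distrib, ← Finset.mul_sum, ← Finset.mul_sum]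
    set A := ∑ j : Fin d → Fin n, ∑ r : Fin d → Fin L, ∑ t' : Fin (L * n),
      (if bpt n M b.1.1 j + tstep (fine n M) b.1.2 (((r b.1.2 : ℕ) + t') / L) = i.1 then
        (T' b.1.1 (glue n L (j, r)) b.1.2 t' - T b.1.1 j b.1.2 (((r b.1.2 : ℕ) + t') / L)) b.2 α'
        else 0) with hA
    set S := ∑ j : Fin d → Fin n, ∑ s : Fin n, Φ j s with hS
    set D := ∑ j : Fin d → Fin n, (Φ j n - Φ j 0) with hD'
    push_cast
    field_simp
    ring
  · simp only [if_neg h, mul_zero, sub_zero]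

end TwoLevel

end Summit.QuantumFields.BalabanUV.T4Continuum.NE2.CovariantTablePairing

end
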